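import Summits.ValiantsHypothesis.ValiantsHypothesis.Theorems.LacunarySymmetroidMatrixDescartesDoorA26WallBubblingBubblingClusters

/-!
# Wall bubbling for `DoorA26` — THE MONGE REVERSAL LEMMA (strict concavity ⇒ the order-reversing matching is the unique maximal permutation term)

HONEST FRAMING.  A self-contained combinatorial lemma for the NEGATIVE-SIDE register of `DoorA26` (stmt-ValiantsHypothesis-19979; OPEN, typed, never
asserted) / `MatrixDescartes` (18050) at `(2,6)`: the paper lemma behind the located note D10 «PATCHWORK CENSUS + MONGE LEMMA» of the line lead
val-idea-15 g4 (crit-5 g3 VERDICT #3 PASS, desk R2843 (B): «patchwork seeds are barren in every chamber»), ported to the kernel so that the register can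
cite a declaration.  W2 seat val-sym-door-p1 g15 (uncommissioned, cheap; offered on the bus before filing).

THE LEMMA (`monge_reversal_unique_max`).  Let `φ : ℝ → ℝ` be STRICTLY CONCAVE and `a : Fin k → ℝ`, `b : Fin k → ℝ` STRICTLY INCREASING (think
`a i = e_{r_i}`, `b j = e_{c_j}` for the rows and columns of ANY `k × k` submatrix of the height matrix `(φ(e_p + e_q))_{p,q<6}` of a chamber).  Then for
every permutation `σ ≠ Fin.revPerm`, `Σ_i φ(a i + b (σ i)) < Σ_i φ(a i + b (rev i))`: the ORDER-REVERSING matching is the UNIQUE maximiser of the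
permutation terms — in principal AND non-principal submatrices alike.  Mechanism: strict concavity gives the strict ANTI-MONGE inequality
`φ(a + b') + φ(a' + b) > φ(a + b) + φ(a' + b')` for `a < a'`, `b < b'` (`monge_swap_gain`), so un-crossing any non-inverted pair strictly increases
the sum; a maximiser exists on the finite set of permutations and must therefore be strictly antitone, i.e. the reversal
(`perm_eq_revPerm_of_strictAnti`, adapted from `Literature…PermutedTubeRealAnchors.perm_eq_rev_of_strictAnti`).

READING (crit-5 / line lead, verbatim scope): with heights `h_{pq} = φ(e_p + e_q)`, `φ` strictly concave, every square minor of the Gram matrix of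
a patchwork (non-cancelling) degeneration has a SINGLE leading monomial, so no `4 × 4` minor can vanish to leading order and rank `≤ 3` is impossible in
the non-cancelling regime — clusters are forced.  That tropical consequence is NOT typed here; this file is the lemma only.

No new definitions; nothing here bears on `DoorA26`, `MatrixDescartes` or `VP ≠ VNP`.

[folklore] rearrangement / Monge arrays; [this work] the port.
-/

-- `Summit.ValiantsHypothesis.ValiantsHypothesis.…` repeats a component by the D-0017 layout
-- (single-conjunct summit), which the `dupNamespace` linter flags; the name is mandated.
set_option linter.dupNamespace false

namespace Summit.ValiantsHypothesis.ValiantsHypothesis.Theorems.LacunarySymmetroidMatrixDescartes.WallBubbling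

open Finset
open scoped BigOperators

/-! ## 1. Strict anti-Monge from strict concavity -/

/-- **Strict four-point inequality of a strictly concave function**: for `x₁ < x₂`, `x₁ < x₃` with `x₂ + x₃ = x₁ + x₄` (so `x₂, x₃` lie strictly
between `x₁` and `x₄`), `φ x₁ + φ x₄ < φ x₂ + φ x₃`. [folklore] -/
theorem strictConcave_four_point {φ : ℝ → ℝ} (hφ : StrictConcaveOn ℝ Set.univ φ) {x₁ x₂ x₃ x₄ : ℝ}
    (h12 : x₁ < x₂) (h13 : x₁ < x₃) (hsum : x₂ + x₃ = x₁ + x₄) : φ x₁ + φ x₄ < φ x₂ + φ x₃ := by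
  have h14 : x₁ < x₄ := by linarith
  have hne : x₁ ≠ x₄ := ne_of_lt h14
  have hd : 0 < x₄ - x₁ := by linarith
  -- barycentric coordinates of `x₂` and `x₃` on `[x₁, x₄]`
  set μ : ℝ := (x₄ - x₂) / (x₄ - x₁) with hμ
  have hμd : μ * (x₄ - x₁) = x₄ - x₂ := by rw [hμ]; field_simp
  have hμ0 : 0 < μ := by rw [hμ]; exact div_pos (by linarith) hd
  have hμ1 : μ < 1 := by
    by_contra hge
    push Not at hge
    have := mul_le_mul_of_nonneg_right hge hd.le
    rw [one_mul, hμd] at this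
    linarith
  have hx₂ : μ * x₁ + (1 - μ) * x₄ = x₂ := by
    calc μ * x₁ + (1 - μ) * x₄ = x₄ - μ * (x₄ - x₁) := by ring
      _ = x₂ := by rw [hμd]; ring
  have hx₃ : (1 - μ) * x₁ + μ * x₄ = x₃ := by
    calc (1 - μ) * x₁ + μ * x₄ = x₁ + μ * (x₄ - x₁) := by ring
      _ = x₃ := by rw [hμd]; linarith
  have h2 := hφ.2 (Set.mem_univ x₁) (Set.mem_univ x₄) hne hμ0 (by linarith) (by ring : μ + (1 - μ) = 1)
  have h3 := hφ.2 (Set.mem_univ x₁) (Set.mem_univ x₄) hne (by linarith : 0 < 1 - μ) hμ0 (by ring : (1 - μ) + μ = 1)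
  simp only [smul_eq_mul] at h2 h3
  rw [hx₂] at h2
  rw [hx₃] at h3
  linarith

/-- **STRICT ANTI-MONGE**: for a strictly concave `φ` and `a < a'`, `b < b'`: `φ(a + b) + φ(a' + b') < φ(a + b') + φ(a' + b)` — un-crossing a pair
strictly increases the permutation term. [folklore] -/
theorem monge_swap_gain {φ : ℝ → ℝ} (hφ : StrictConcaveOn ℝ Set.univ φ) {a a' b b' : ℝ} (ha : a < a') (hb : b < b') :
    φ (a + b) + φ (a' + b') < φ (a + b') + φ (a' + b) :=
  strictConcave_four_point hφ (x₁ := a + b) (x₂ := a + b') (x₃ := a' + b) (x₄ := a' + b')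
    (by linarith [hb]) (by linarith [ha]) (by ring)

/-! ## 2. Permutations of `Fin k`: the reversal -/

/-- A strictly monotone permutation of `Fin k` is the identity. [folklore]
-- adapted from `Literature.MathematicalPhysics.QuantumLattice.PermutedTubeRealAnchors.perm_eq_one_of_strictMono` -/
theorem perm_eq_one_of_strictMono' {k : ℕ} {σ : Equiv.Perm (Fin k)} (hσ : StrictMono σ) : σ = 1 := by
  have h : (σ : Fin k → Fin k) = id :=
    (hσ.range_inj strictMono_id).1 (by rw [σ.surjective.range_eq, Set.range_id])
  ext i
  exact congrArg Fin.val (congrFun h i)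

/-- A strictly antitone permutation of `Fin k` is the reversal `Fin.revPerm`. [folklore]
-- adapted from `Literature.MathematicalPhysics.QuantumLattice.PermutedTubeRealAnchors.perm_eq_rev_of_strictAnti` -/
theorem perm_eq_revPerm_of_strictAnti {k : ℕ} {σ : Equiv.Perm (Fin k)} (hσ : StrictAnti σ) : σ = Fin.revPerm := by
  set ρ : Equiv.Perm (Fin k) := Fin.revPerm with hρ
  have hm : StrictMono ⇑(σ * ρ) := by
    intro i j hij
    show σ (Fin.rev i) < σ (Fin.rev j)
    exact hσ (Fin.rev_lt_rev.2 hij)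
  have h1 := perm_eq_one_of_strictMono' hm
  have hρρ : ρ * ρ = 1 := by
    ext i
    simp [hρ, Equiv.Perm.mul_apply]
  calc σ = σ * ρ * ρ := by rw [mul_assoc, hρρ, mul_one]
    _ = ρ := by rw [h1, one_mul]

/-! ## 3. The Monge reversal lemma -/

/-- **One un-crossing step.**  If `σ` has a non-inverted pair `i < j`, `σ i < σ j`, then composing with the transposition of `i, j` strictly
increases `Σ_l φ(a l + b (σ l))`. [folklore] -/
theorem monge_uncross {φ : ℝ → ℝ} (hφ : StrictConcaveOn ℝ Set.univ φ) {k : ℕ} {a b : Fin k → ℝ} (ha : StrictMono a) (hb : StrictMono b)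
    (σ : Equiv.Perm (Fin k)) {i j : Fin k} (hij : i < j) (hσ : σ i < σ j) :
    ∑ l, φ (a l + b (σ l)) < ∑ l, φ (a l + b ((σ * Equiv.swap i j) l)) := by
  classical
  have hne : i ≠ j := ne_of_lt hij
  -- split off the two moving terms
  have hsplit : ∀ τ : Equiv.Perm (Fin k), ∑ l, φ (a l + b (τ l))
      = φ (a i + b (τ i)) + φ (a j + b (τ j)) + ∑ l ∈ (univ.erase i).erase j, φ (a l + b (τ l)) := by
    intro τ
    rw [← Finset.add_sum_erase _ _ (Finset.mem_univ i), ← Finset.add_sum_erase _ _ (Finset.mem_erase.mpr ⟨hne.symm, Finset.mem_univ j⟩)]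
    ring
  rw [hsplit σ, hsplit (σ * Equiv.swap i j)]
  have hrest : ∑ l ∈ (univ.erase i).erase j, φ (a l + b ((σ * Equiv.swap i j) l))
      = ∑ l ∈ (univ.erase i).erase j, φ (a l + b (σ l)) := by
    refine Finset.sum_congr rfl fun l hl => ?_
    obtain ⟨hlj, hl'⟩ := Finset.mem_erase.mp hl
    obtain ⟨hli, -⟩ := Finset.mem_erase.mp hl'
    rw [Equiv.Perm.mul_apply, Equiv.swap_apply_of_ne_of_ne hli hlj]
  rw [hrest, Equiv.Perm.mul_apply, Equiv.Perm.mul_apply, Equiv.swap_apply_left, Equiv.swap_apply_right]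
  have key := monge_swap_gain hφ (ha hij) (hb hσ)
  linarith

/-- **THE MONGE REVERSAL LEMMA.**  For a strictly concave `φ` and strictly increasing `a, b : Fin k → ℝ`, the order-reversing matching is the
UNIQUE maximiser of `σ ↦ Σ_i φ(a i + b (σ i))` over the permutations of `Fin k`. [folklore: Monge arrays; this work: the port] -/
theorem monge_reversal_unique_max {φ : ℝ → ℝ} (hφ : StrictConcaveOn ℝ Set.univ φ) {k : ℕ} {a b : Fin k → ℝ} (ha : StrictMono a) (hb : StrictMono b)
    (σ : Equiv.Perm (Fin k)) (hσ : σ ≠ Fin.revPerm) :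
    ∑ i, φ (a i + b (σ i)) < ∑ i, φ (a i + b (Fin.revPerm i)) := by
  classical
  -- a maximiser exists and is strictly antitone, hence the reversal
  obtain ⟨τ, -, hτ⟩ := Finset.exists_max_image (univ : Finset (Equiv.Perm (Fin k))) (fun τ => ∑ i, φ (a i + b (τ i))) Finset.univ_nonempty
  have hτanti : StrictAnti τ := by
    intro i j hij
    by_contra hle
    push Not at hle
    rcases hle.lt_or_eq with hlt | heq
    · have h := monge_uncross hφ ha hb τ hij hlt
      have h' := hτ (τ * Equiv.swap i j) (Finset.mem_univ _)
      linarith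
    · exact absurd (τ.injective heq) (ne_of_lt hij)
  have hτrev : τ = Fin.revPerm := perm_eq_revPerm_of_strictAnti hτanti
  subst hτrev
  -- `σ ≠ rev` is not strictly antitone, so it has a non-inverted pair and is strictly improvable
  have hσanti : ¬ StrictAnti σ := fun h => hσ (perm_eq_revPerm_of_strictAnti h)
  obtain ⟨i, j, hij, hle⟩ : ∃ i j : Fin k, i < j ∧ σ i ≤ σ j := by
    by_contra h
    push Not at h
    exact hσanti fun i j hij => h i j hij
  rcases hle.lt_or_eq with hlt | heq
  · have h := monge_uncross hφ ha hb σ hij hlt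
    have h' := hτ (σ * Equiv.swap i j) (Finset.mem_univ _)
    linarith
  · exact absurd (σ.injective heq) (ne_of_lt hij)

/-- **Corollary for the height matrix of a chamber** (any square submatrix, principal or not): with `e` strictly increasing and rows `r`, columns `c`
strictly increasing selections, every permutation term other than the order-reversing one is strictly smaller. [this work] -/
theorem monge_reversal_heights {φ : ℝ → ℝ} (hφ : StrictConcaveOn ℝ Set.univ φ) {n k : ℕ} {e : Fin n → ℝ} (he : StrictMono e)
    {r c : Fin k → Fin n} (hr : StrictMono r) (hc : StrictMono c) (σ : Equiv.Perm (Fin k)) (hσ : σ ≠ Fin.revPerm) :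
    ∑ i, φ (e (r i) + e (c (σ i))) < ∑ i, φ (e (r i) + e (c (Fin.revPerm i))) :=
  monge_reversal_unique_max hφ (a := fun i => e (r i)) (b := fun j => e (c j)) (he.comp hr) (he.comp hc) σ hσ

end Summit.ValiantsHypothesis.ValiantsHypothesis.Theorems.LacunarySymmetroidMatrixDescartes.WallBubbling
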